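import Summits.CriticalPhenomena.PercolationContinuityZ3.Theorems.PercNearOneGluingNoHeavyQuantLSCoreMMGIneqA
import Summits.CriticalPhenomena.PercolationContinuityZ3.Theorems.PercNearOneGluingNoHeavyQuantLSCoreLMGIneqA
import Summits.CriticalPhenomena.PercolationContinuityZ3.Theorems.PercNearOneGluingNoHeavyQuantLSCoreLMGIneqF
import Summits.CriticalPhenomena.PercolationContinuityZ3.Theorems.PercNearOneGluingNoHeavyQuantLSCoreLMGIneqG
import Summits.CriticalPhenomena.PercolationContinuityZ3.Theorems.PercNearOneGluingNoHeavyQuantLSCoreLMGIneqH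
import Summits.CriticalPhenomena.PercolationContinuityZ3.Theorems.PercNearOneGluingNoHeavyQuantLSCoreLMGIneqI
import Summits.CriticalPhenomena.PercolationContinuityZ3.Theorems.PercNearOneGluingNoHeavyQuantLSCoreLMGIneqJ
import Summits.CriticalPhenomena.PercolationContinuityZ3.Theorems.PercNearOneGluingNoHeavyQuantLSCoreLMGIneqK
import Summits.CriticalPhenomena.PercolationContinuityZ3.Theorems.PercNearOneGluingNoHeavyQuantLSCoreLMGIneqL
import Mathlib.Tactic.Linarith
import Mathlib.Tactic.FieldSimp
import Mathlib.Tactic.Ring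
import HarnessLib

/-!
# QUANT lane R8, T-DEC, binder (II) `ConvClosedTResidue`: LS-CORE, pattern LMG — the breakpoint inequalities of the two-low greedy after
# pre-routing the row-`m` low `m+l` into the head cell, by case analysis over the letters of the cross pairs (kG)

builds on p205010 (kernel theorem, internal audit signed; external expert review pending)

Support file (`--supports stmt-CriticalPhenomena-4575`), QUANT lane seat prim-quant-census-1 (gen 22), rung R8 of
`run/shared/lean/prim/quant/LADDER.md`.  Theorems only, standard axioms, no sorries.  Memo `…/prim-quant-census-1/LSCORE-G22.md` §9–§10.

Scale-free coordinates of `…QuantLSCoreMMGIneqA` (`x, r, t, d, w`); efficiencies `e2P, e22` (low `p+l′` into `p+h`, `m+l′`), `e3` (the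
pre-routed low `m+l` into `p+h`, deficit `r+d+2t−2w`, span `1+t−w`), the head-cell exchange ratio `κ`, and the residual head-cell capacity
`cPres` / residual pool `poolres` after pre-routing (fits: `cPres = c_P − d₁/e3`, `poolres = pool`; saturates: `cPres = 0`,
`poolres = pool − d₁ + c_P·e3`), all given by conditional closed forms.  The lemmas are the hypotheses `hkG`, `hkB` (and the facts used for
`hkA`) of `LawDec.twoLow_greedy_flows` for pattern LMG; every leaf is one cell of `…QuantLSCoreLMGIneq*`.

[this work].  The gluing rows served [cite: KozmaNitzan2024, Conjecture 3 (p. 15)]; product measure [cite: Grimmett1999, §1.3 p. 10].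
-/

namespace Summit.CriticalPhenomena.PercolationContinuityZ3.Theorems

namespace Quant

namespace LawDec

namespace LSCoreLMG

set_option maxHeartbeats 8000000 in
/-- **`kG` for pattern LMG (breakpoint at the giant pool after pre-routing `m+l`)**: `P₁ + P₂ ≤ a₂(m+l′) + a₂(p+h)′ + pool′`. [this work] -/
theorem kG_LMG (x r t d w e2P e22 e3 cPres poolres : ℝ) (hx0 : 0 < x) (hx1 : x < 1) (hr0 : 0 ≤ r) (hrx : r < x) (ht : 0 < t) (hw0 : 0 < w) (hw1 : w ≤ 1)
    (hd0 : 0 ≤ d) (hdx : d < x * w) (hre : 0 < r - x + t * (2 - x)) (hre1 : 0 < 1 - t - r)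
    (hM1 : 2 * w < r + d + 2 * t) (hM2 : r + d ≤ 2 * w)
    (h2P_N : 1 ≤ (r + d) → e2P = 0)
    (h2P_H : x ≤ (r + d) → (r + d) < 1 → e2P = (1 / (r + d) - 1))
    (h2P_L : (r + d) < x → e2P = (1 / ((1 - x) * (r + d) + x ^ (2:ℕ)) - 1))
    (h22_N : w ≤ (r + d) → e22 = 0)
    (h22_H : x * w ≤ (r + d) → (r + d) < w → e22 = (w / (r + d) - 1))
    (h22_L : (r + d) < x * w → e22 = (w / ((1 - x) * (r + d) + x ^ (2:ℕ) * w) - 1))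
    (h3_H : x * (1 + t - w) ≤ (r + d + 2 * t - 2 * w) → e3 = (((1 + t - w) - (r + d + 2 * t - 2 * w)) / (r + d + 2 * t - 2 * w)))
    (h3_L : (r + d + 2 * t - 2 * w) < x * (1 + t - w) → e3 = (((1 + t - w) - ((1 - x) * (r + d + 2 * t - 2 * w) + x ^ (2:ℕ) * (1 + t - w))) / ((1 - x) * (r + d + 2 * t - 2 * w) + x ^ (2:ℕ) * (1 + t - w))))
    (hcase_f : ((x ^ (2:ℕ) + (1 - x) * d / w) * (1 - x) * ((x - r) * (1 - t - r) / (t * (2 - x ^ (2:ℕ) - (1 - x) * r) - x * (x - r)))) ≤ ((1 - (x ^ (2:ℕ) + (1 - x) * d / w)) * x) * e3 → cPres = ((1 - (x ^ (2:ℕ) + (1 - x) * d / w)) * x) - ((x ^ (2:ℕ) + (1 - x) * d / w) * (1 - x) * ((x - r) * (1 - t - r) / (t * (2 - x ^ (2:ℕ) - (1 - x) * r) - x * (x - r)))) / e3 ∧ poolres = ((x ^ (2:ℕ) + (1 - x) * d / w) * (1 - x)))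
    (hcase_s : ((1 - (x ^ (2:ℕ) + (1 - x) * d / w)) * x) * e3 < ((x ^ (2:ℕ) + (1 - x) * d / w) * (1 - x) * ((x - r) * (1 - t - r) / (t * (2 - x ^ (2:ℕ) - (1 - x) * r) - x * (x - r)))) → cPres = 0 ∧ poolres = (((x ^ (2:ℕ) + (1 - x) * d / w) * (1 - x)) - ((x ^ (2:ℕ) + (1 - x) * d / w) * (1 - x) * ((x - r) * (1 - t - r) / (t * (2 - x ^ (2:ℕ) - (1 - x) * r) - x * (x - r)))) + ((1 - (x ^ (2:ℕ) + (1 - x) * d / w)) * x) * e3))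
    (hpre : ((x ^ (2:ℕ) + (1 - x) * d / w) * (1 - x) * ((1 + x - r) * (r - x + t * (2 - x)) / (t * (2 - x ^ (2:ℕ) - (1 - x) * r) - x * (x - r)))) * e22 + cPres * e2P ≤ ((1 - (x ^ (2:ℕ) + (1 - x) * d / w)) * (1 - x) * ((1 + x - r) * (r - x + t * (2 - x)) / (t * (2 - x ^ (2:ℕ) - (1 - x) * r) - x * (x - r))))) :
    ((1 - (x ^ (2:ℕ) + (1 - x) * d / w)) * (1 - x) * ((x - r) * (1 - t - r) / (t * (2 - x ^ (2:ℕ) - (1 - x) * r) - x * (x - r)))) + ((1 - (x ^ (2:ℕ) + (1 - x) * d / w)) * (1 - x) * ((1 + x - r) * (r - x + t * (2 - x)) / (t * (2 - x ^ (2:ℕ) - (1 - x) * r) - x * (x - r)))) ≤ ((x ^ (2:ℕ) + (1 - x) * d / w) * (1 - x) * ((1 + x - r) * (r - x + t * (2 - x)) / (t * (2 - x ^ (2:ℕ) - (1 - x) * r) - x * (x - r)))) * e22 + cPres * e2P + poolres := by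
  have hD : 0 < t * (2 - x ^ (2:ℕ) - (1 - x) * r) - x * (x - r) := LSCoreMMG.D_pos x r t hx0 hx1 hr0 hrx hre
  have hxw : x * w ≤ x := by nlinarith
  have hxw1 : x * w ≤ w := by nlinarith
  have hb3c : r + d + 2 * t - 2 * w < 1 + t - w := by nlinarith
  have hg0 : 0 ≤ (x ^ (2:ℕ) + (1 - x) * d / w) := by positivity
  have hlaml : 0 ≤ ((1 + x - r) * (r - x + t * (2 - x)) / (t * (2 - x ^ (2:ℕ) - (1 - x) * r) - x * (x - r))) := div_nonneg (mul_nonneg (by linarith) hre.le) hD.le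
  have hcM2 : 0 ≤ ((x ^ (2:ℕ) + (1 - x) * d / w) * (1 - x) * ((1 + x - r) * (r - x + t * (2 - x)) / (t * (2 - x ^ (2:ℕ) - (1 - x) * r) - x * (x - r)))) := mul_nonneg (mul_nonneg hg0 (by linarith)) hlaml
  have hsum : ((x - r) * (1 - t - r) / (t * (2 - x ^ (2:ℕ) - (1 - x) * r) - x * (x - r))) + ((1 + x - r) * (r - x + t * (2 - x)) / (t * (2 - x ^ (2:ℕ) - (1 - x) * r) - x * (x - r))) = 1 := by rw [← add_div, div_eq_one_iff_eq hD.ne']; ring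
  have hP : ((1 - (x ^ (2:ℕ) + (1 - x) * d / w)) * (1 - x) * ((x - r) * (1 - t - r) / (t * (2 - x ^ (2:ℕ) - (1 - x) * r) - x * (x - r)))) + ((1 - (x ^ (2:ℕ) + (1 - x) * d / w)) * (1 - x) * ((1 + x - r) * (r - x + t * (2 - x)) / (t * (2 - x ^ (2:ℕ) - (1 - x) * r) - x * (x - r)))) = (1 - (x ^ (2:ℕ) + (1 - x) * d / w)) * (1 - x) := by linear_combination (1 - (x ^ (2:ℕ) + (1 - x) * d / w)) * (1 - x) * hsum
  have hg1p : 0 ≤ 1 - (x ^ (2:ℕ) + (1 - x) * d / w) := by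
    have h4 : d / w ≤ x := by rw [div_le_iff₀ hw0]; linarith
    have h5 : (1 - x) * d / w ≤ (1 - x) * x := by rw [mul_div_assoc]; exact mul_le_mul_of_nonneg_left h4 (by linarith)
    nlinarith
  have hlam : 0 ≤ ((x - r) * (1 - t - r) / (t * (2 - x ^ (2:ℕ) - (1 - x) * r) - x * (x - r))) := div_nonneg (mul_nonneg (by linarith) (by linarith)) hD.le
  have hcM1 : 0 ≤ ((x ^ (2:ℕ) + (1 - x) * d / w) * (1 - x) * ((x - r) * (1 - t - r) / (t * (2 - x ^ (2:ℕ) - (1 - x) * r) - x * (x - r)))) := mul_nonneg (mul_nonneg hg0 (by linarith)) hlam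
  have hgl : ((x ^ (2:ℕ) + (1 - x) * d / w) * (1 - x) * ((x - r) * (1 - t - r) / (t * (2 - x ^ (2:ℕ) - (1 - x) * r) - x * (x - r)))) ≤ (x ^ (2:ℕ) + (1 - x) * d / w) * (1 - x) := mul_le_of_le_one_right (mul_nonneg hg0 (by linarith)) (by linarith [hsum, hlaml])
  have hgsum : (x ^ (2:ℕ) + (1 - x) * d / w) * (1 - x) * ((x - r) * (1 - t - r) / (t * (2 - x ^ (2:ℕ) - (1 - x) * r) - x * (x - r))) + (x ^ (2:ℕ) + (1 - x) * d / w) * (1 - x) * ((1 + x - r) * (r - x + t * (2 - x)) / (t * (2 - x ^ (2:ℕ) - (1 - x) * r) - x * (x - r))) = (x ^ (2:ℕ) + (1 - x) * d / w) * (1 - x) := by rw [← mul_add, hsum, mul_one]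
  rcases le_or_gt (((x ^ (2:ℕ) + (1 - x) * d / w) * (1 - x) * ((x - r) * (1 - t - r) / (t * (2 - x ^ (2:ℕ) - (1 - x) * r) - x * (x - r))))) (((1 - (x ^ (2:ℕ) + (1 - x) * d / w)) * x) * e3) with hf | hs
  · obtain ⟨hcP, hpl⟩ := hcase_f hf
    rw [hcP] at hpre ⊢
    rw [hpl]
    clear hcase_f hcase_s
    rcases le_or_gt (x * (1 + t - w)) ((r + d + 2 * t - 2 * w)) with hk3 | hk3
    · rw [h3_H hk3] at *
      rcases lt_or_ge ((r + d)) x with h2L | h2H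
      · rw [h2P_L h2L] at hpre ⊢
        have hG : 0 < ((1 - x) * (r + d) + x ^ (2:ℕ)) := by positivity
        have he22 : 0 ≤ e22 := by
          rcases lt_or_ge ((r + d)) (x * w) with h1 | h1
          · rw [h22_L h1]
            have hG2 : 0 < ((1 - x) * (r + d) + x ^ (2:ℕ) * w) := by positivity
            rw [sub_nonneg, le_div_iff₀ hG2]; nlinarith [mul_pos hx0 hx0]
          · rcases lt_or_ge ((r + d)) w with h2 | h2
            · rw [h22_H h1 h2]
              have hA : 0 < (r + d) := by nlinarith [mul_pos hx0 hw0]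
              rw [sub_nonneg, le_div_iff₀ hA]; linarith
            · rw [h22_N h2]
        have hxG : ((1 - x) * (r + d) + x ^ (2:ℕ)) ≤ x := by nlinarith [mul_le_mul_of_nonneg_left h2L.le (sub_pos.2 hx1).le]
        have he2 : (1 - x) / x ≤ (1 / ((1 - x) * (r + d) + x ^ (2:ℕ)) - 1) := by
          rw [div_le_iff₀ hx0]
          have h1x : 1 ≤ x / ((1 - x) * (r + d) + x ^ (2:ℕ)) := by rw [le_div_iff₀ hG]; linarith
          have : (1 / ((1 - x) * (r + d) + x ^ (2:ℕ)) - 1) * x = x / ((1 - x) * (r + d) + x ^ (2:ℕ)) - x := by ring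
          linarith [this, h1x]
        have he3pos : 0 < (((1 + t - w) - (r + d + 2 * t - 2 * w)) / (r + d + 2 * t - 2 * w)) := div_pos (by linarith) (by linarith)
        have hs0 : 0 ≤ (((1 - (x ^ (2:ℕ) + (1 - x) * d / w)) * x) - ((x ^ (2:ℕ) + (1 - x) * d / w) * (1 - x) * ((x - r) * (1 - t - r) / (t * (2 - x ^ (2:ℕ) - (1 - x) * r) - x * (x - r)))) / (((1 + t - w) - (r + d + 2 * t - 2 * w)) / (r + d + 2 * t - 2 * w))) := by have := (div_le_iff₀ he3pos).2 hf; linarith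
        have hW := ineq_W_3PH x r t d w hx0 hx1 hr0 hrx ht hw0 hw1 hd0 hdx hre hre1 hM1 hM2 hk3 hb3c
        have hse : ((x - r) * (1 - t - r) / (t * (2 - x ^ (2:ℕ) - (1 - x) * r) - x * (x - r))) * (x * (((1 + t - w) - (r + d + 2 * t - 2 * w)) / (r + d + 2 * t - 2 * w))) + ((1 + x - r) * (r - x + t * (2 - x)) / (t * (2 - x ^ (2:ℕ) - (1 - x) * r) - x * (x - r))) * (x * (((1 + t - w) - (r + d + 2 * t - 2 * w)) / (r + d + 2 * t - 2 * w))) = x * (((1 + t - w) - (r + d + 2 * t - 2 * w)) / (r + d + 2 * t - 2 * w)) := by rw [← add_mul, hsum, one_mul]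
        have hW2 : ((x - r) * (1 - t - r) / (t * (2 - x ^ (2:ℕ) - (1 - x) * r) - x * (x - r))) * (1 - x) ≤ x * (((1 + t - w) - (r + d + 2 * t - 2 * w)) / (r + d + 2 * t - 2 * w)) := by nlinarith [hW, hse]
        have hμ0 : ((x - r) * (1 - t - r) / (t * (2 - x ^ (2:ℕ) - (1 - x) * r) - x * (x - r))) * ((1 - x) / (x * (((1 + t - w) - (r + d + 2 * t - 2 * w)) / (r + d + 2 * t - 2 * w)))) ≤ 1 := by
          rw [← mul_div_assoc, div_le_one (by positivity)]; linarith [hW2]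
        have hμ : ((x ^ (2:ℕ) + (1 - x) * d / w) * (1 - x) * ((x - r) * (1 - t - r) / (t * (2 - x ^ (2:ℕ) - (1 - x) * r) - x * (x - r)))) * ((1 - x) / (x * (((1 + t - w) - (r + d + 2 * t - 2 * w)) / (r + d + 2 * t - 2 * w)))) ≤ (x ^ (2:ℕ) + (1 - x) * d / w) * (1 - x) := by
          have : ((x ^ (2:ℕ) + (1 - x) * d / w) * (1 - x) * ((x - r) * (1 - t - r) / (t * (2 - x ^ (2:ℕ) - (1 - x) * r) - x * (x - r)))) * ((1 - x) / (x * (((1 + t - w) - (r + d + 2 * t - 2 * w)) / (r + d + 2 * t - 2 * w)))) = ((x ^ (2:ℕ) + (1 - x) * d / w) * (1 - x)) * (((x - r) * (1 - t - r) / (t * (2 - x ^ (2:ℕ) - (1 - x) * r) - x * (x - r))) * ((1 - x) / (x * (((1 + t - w) - (r + d + 2 * t - 2 * w)) / (r + d + 2 * t - 2 * w))))) := by ring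
          rw [this]; exact mul_le_of_le_one_right (mul_nonneg hg0 (by linarith)) hμ0
        have e1 : ((1 - (x ^ (2:ℕ) + (1 - x) * d / w)) * x) * ((1 - x) / x) = (1 - (x ^ (2:ℕ) + (1 - x) * d / w)) * (1 - x) := by field_simp
        have e2 : (((x ^ (2:ℕ) + (1 - x) * d / w) * (1 - x) * ((x - r) * (1 - t - r) / (t * (2 - x ^ (2:ℕ) - (1 - x) * r) - x * (x - r)))) / (((1 + t - w) - (r + d + 2 * t - 2 * w)) / (r + d + 2 * t - 2 * w))) * ((1 - x) / x) = ((x ^ (2:ℕ) + (1 - x) * d / w) * (1 - x) * ((x - r) * (1 - t - r) / (t * (2 - x ^ (2:ℕ) - (1 - x) * r) - x * (x - r)))) * ((1 - x) / (x * (((1 + t - w) - (r + d + 2 * t - 2 * w)) / (r + d + 2 * t - 2 * w)))) := by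
          rw [div_mul_div_comm, mul_comm ((((1 + t - w) - (r + d + 2 * t - 2 * w)) / (r + d + 2 * t - 2 * w))) x, mul_div_assoc]
        have f1 : (((1 - (x ^ (2:ℕ) + (1 - x) * d / w)) * x) - ((x ^ (2:ℕ) + (1 - x) * d / w) * (1 - x) * ((x - r) * (1 - t - r) / (t * (2 - x ^ (2:ℕ) - (1 - x) * r) - x * (x - r)))) / (((1 + t - w) - (r + d + 2 * t - 2 * w)) / (r + d + 2 * t - 2 * w))) * ((1 - x) / x) ≤ (((1 - (x ^ (2:ℕ) + (1 - x) * d / w)) * x) - ((x ^ (2:ℕ) + (1 - x) * d / w) * (1 - x) * ((x - r) * (1 - t - r) / (t * (2 - x ^ (2:ℕ) - (1 - x) * r) - x * (x - r)))) / (((1 + t - w) - (r + d + 2 * t - 2 * w)) / (r + d + 2 * t - 2 * w))) * (1 / ((1 - x) * (r + d) + x ^ (2:ℕ)) - 1) := mul_le_mul_of_nonneg_left he2 hs0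
        have f2 : (((1 - (x ^ (2:ℕ) + (1 - x) * d / w)) * x) - ((x ^ (2:ℕ) + (1 - x) * d / w) * (1 - x) * ((x - r) * (1 - t - r) / (t * (2 - x ^ (2:ℕ) - (1 - x) * r) - x * (x - r)))) / (((1 + t - w) - (r + d + 2 * t - 2 * w)) / (r + d + 2 * t - 2 * w))) * ((1 - x) / x) = ((1 - (x ^ (2:ℕ) + (1 - x) * d / w)) * x) * ((1 - x) / x) - (((x ^ (2:ℕ) + (1 - x) * d / w) * (1 - x) * ((x - r) * (1 - t - r) / (t * (2 - x ^ (2:ℕ) - (1 - x) * r) - x * (x - r)))) / (((1 + t - w) - (r + d + 2 * t - 2 * w)) / (r + d + 2 * t - 2 * w))) * ((1 - x) / x) := by ring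
        nlinarith [f1, f2, e1, e2, hμ, hP, mul_nonneg hcM2 he22]
      · rcases lt_or_ge ((r + d)) 1 with h2b | h2n
        · rw [h2P_H h2H h2b] at hpre ⊢
          rcases lt_or_ge ((r + d)) w with h22b | h22n
          · rw [h22_H (le_trans hxw h2H) h22b] at hpre ⊢
            have hc := ineq_kG_3PHf_H_H x r t d w hx0 hx1 hr0 hrx ht hw0 hw1 hd0 hdx hre hre1 hM1 hM2 hk3 hb3c hf (le_trans hxw h2H) h22b h2H h2b (by simpa only [zero_mul, mul_zero, add_zero, zero_add] using hpre)
            linarith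
          · rw [h22_N h22n] at hpre ⊢
            have hc := ineq_kG_3PHf_N_H x r t d w hx0 hx1 hr0 hrx ht hw0 hw1 hd0 hdx hre hre1 hM1 hM2 hk3 hb3c hf h22n h2H h2b (by simpa only [zero_mul, mul_zero, add_zero, zero_add] using hpre)
            linarith
        · rw [h2P_N h2n, h22_N (le_trans hw1 h2n)] at hpre ⊢
          have hc := ineq_kG_3PHf_N_N x r t d w hx0 hx1 hr0 hrx ht hw0 hw1 hd0 hdx hre hre1 hM1 hM2 hk3 hb3c hf (le_trans hw1 h2n) h2n (by simpa only [zero_mul, mul_zero, add_zero, zero_add] using hpre)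
          linarith

    · rw [h3_L hk3] at *
      rcases lt_or_ge ((r + d)) x with h2L | h2H
      · rw [h2P_L h2L] at hpre ⊢
        have hG : 0 < ((1 - x) * (r + d) + x ^ (2:ℕ)) := by positivity
        have he22 : 0 ≤ e22 := by
          rcases lt_or_ge ((r + d)) (x * w) with h1 | h1
          · rw [h22_L h1]
            have hG2 : 0 < ((1 - x) * (r + d) + x ^ (2:ℕ) * w) := by positivity
            rw [sub_nonneg, le_div_iff₀ hG2]; nlinarith [mul_pos hx0 hx0]
          · rcases lt_or_ge ((r + d)) w with h2 | h2
            · rw [h22_H h1 h2]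
              have hA : 0 < (r + d) := by nlinarith [mul_pos hx0 hw0]
              rw [sub_nonneg, le_div_iff₀ hA]; linarith
            · rw [h22_N h2]
        have hxG : ((1 - x) * (r + d) + x ^ (2:ℕ)) ≤ x := by nlinarith [mul_le_mul_of_nonneg_left h2L.le (sub_pos.2 hx1).le]
        have he2 : (1 - x) / x ≤ (1 / ((1 - x) * (r + d) + x ^ (2:ℕ)) - 1) := by
          rw [div_le_iff₀ hx0]
          have h1x : 1 ≤ x / ((1 - x) * (r + d) + x ^ (2:ℕ)) := by rw [le_div_iff₀ hG]; linarith
          have : (1 / ((1 - x) * (r + d) + x ^ (2:ℕ)) - 1) * x = x / ((1 - x) * (r + d) + x ^ (2:ℕ)) - x := by ring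
          linarith [this, h1x]
        have hG3pos : 0 < ((1 - x) * (r + d + 2 * t - 2 * w) + x ^ (2:ℕ) * (1 + t - w)) := add_pos_of_pos_of_nonneg (mul_pos (by linarith) (by linarith)) (mul_nonneg (sq_nonneg x) (by linarith))
        have he3pos : 0 < (((1 + t - w) - ((1 - x) * (r + d + 2 * t - 2 * w) + x ^ (2:ℕ) * (1 + t - w))) / ((1 - x) * (r + d + 2 * t - 2 * w) + x ^ (2:ℕ) * (1 + t - w))) := div_pos (by nlinarith [mul_pos hx0 (sub_pos.2 hx1), mul_pos hx0 (show (0:ℝ) < 1 + t - w by linarith)]) hG3pos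
        have he3 : (1 - x) / x ≤ (((1 + t - w) - ((1 - x) * (r + d + 2 * t - 2 * w) + x ^ (2:ℕ) * (1 + t - w))) / ((1 - x) * (r + d + 2 * t - 2 * w) + x ^ (2:ℕ) * (1 + t - w))) := by
          rw [div_le_div_iff₀ hx0 hG3pos]; nlinarith [mul_le_mul_of_nonneg_left hk3.le (sub_pos.2 hx1).le]
        have hs0 : 0 ≤ (((1 - (x ^ (2:ℕ) + (1 - x) * d / w)) * x) - ((x ^ (2:ℕ) + (1 - x) * d / w) * (1 - x) * ((x - r) * (1 - t - r) / (t * (2 - x ^ (2:ℕ) - (1 - x) * r) - x * (x - r)))) / (((1 + t - w) - ((1 - x) * (r + d + 2 * t - 2 * w) + x ^ (2:ℕ) * (1 + t - w))) / ((1 - x) * (r + d + 2 * t - 2 * w) + x ^ (2:ℕ) * (1 + t - w)))) := by have := (div_le_iff₀ he3pos).2 hf; linarith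
        have hμ0 : (1 - x) / (x * (((1 + t - w) - ((1 - x) * (r + d + 2 * t - 2 * w) + x ^ (2:ℕ) * (1 + t - w))) / ((1 - x) * (r + d + 2 * t - 2 * w) + x ^ (2:ℕ) * (1 + t - w)))) ≤ 1 := by
          rw [div_le_one (by positivity)]
          have := (div_le_iff₀ hx0).1 he3
          linarith
        have hμ : ((x ^ (2:ℕ) + (1 - x) * d / w) * (1 - x) * ((x - r) * (1 - t - r) / (t * (2 - x ^ (2:ℕ) - (1 - x) * r) - x * (x - r)))) * ((1 - x) / (x * (((1 + t - w) - ((1 - x) * (r + d + 2 * t - 2 * w) + x ^ (2:ℕ) * (1 + t - w))) / ((1 - x) * (r + d + 2 * t - 2 * w) + x ^ (2:ℕ) * (1 + t - w))))) ≤ (x ^ (2:ℕ) + (1 - x) * d / w) * (1 - x) := le_trans (mul_le_of_le_one_right hcM1 hμ0) hgl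
        have e1 : ((1 - (x ^ (2:ℕ) + (1 - x) * d / w)) * x) * ((1 - x) / x) = (1 - (x ^ (2:ℕ) + (1 - x) * d / w)) * (1 - x) := by field_simp
        have e2 : (((x ^ (2:ℕ) + (1 - x) * d / w) * (1 - x) * ((x - r) * (1 - t - r) / (t * (2 - x ^ (2:ℕ) - (1 - x) * r) - x * (x - r)))) / (((1 + t - w) - ((1 - x) * (r + d + 2 * t - 2 * w) + x ^ (2:ℕ) * (1 + t - w))) / ((1 - x) * (r + d + 2 * t - 2 * w) + x ^ (2:ℕ) * (1 + t - w)))) * ((1 - x) / x) = ((x ^ (2:ℕ) + (1 - x) * d / w) * (1 - x) * ((x - r) * (1 - t - r) / (t * (2 - x ^ (2:ℕ) - (1 - x) * r) - x * (x - r)))) * ((1 - x) / (x * (((1 + t - w) - ((1 - x) * (r + d + 2 * t - 2 * w) + x ^ (2:ℕ) * (1 + t - w))) / ((1 - x) * (r + d + 2 * t - 2 * w) + x ^ (2:ℕ) * (1 + t - w))))) := by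
          rw [div_mul_div_comm, mul_comm ((((1 + t - w) - ((1 - x) * (r + d + 2 * t - 2 * w) + x ^ (2:ℕ) * (1 + t - w))) / ((1 - x) * (r + d + 2 * t - 2 * w) + x ^ (2:ℕ) * (1 + t - w)))) x, mul_div_assoc]
        have f1 : (((1 - (x ^ (2:ℕ) + (1 - x) * d / w)) * x) - ((x ^ (2:ℕ) + (1 - x) * d / w) * (1 - x) * ((x - r) * (1 - t - r) / (t * (2 - x ^ (2:ℕ) - (1 - x) * r) - x * (x - r)))) / (((1 + t - w) - ((1 - x) * (r + d + 2 * t - 2 * w) + x ^ (2:ℕ) * (1 + t - w))) / ((1 - x) * (r + d + 2 * t - 2 * w) + x ^ (2:ℕ) * (1 + t - w)))) * ((1 - x) / x) ≤ (((1 - (x ^ (2:ℕ) + (1 - x) * d / w)) * x) - ((x ^ (2:ℕ) + (1 - x) * d / w) * (1 - x) * ((x - r) * (1 - t - r) / (t * (2 - x ^ (2:ℕ) - (1 - x) * r) - x * (x - r)))) / (((1 + t - w) - ((1 - x) * (r + d + 2 * t - 2 * w) + x ^ (2:ℕ) * (1 + t - w))) / ((1 - x) * (r + d + 2 * t - 2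 * w) + x ^ (2:ℕ) * (1 + t - w)))) * (1 / ((1 - x) * (r + d) + x ^ (2:ℕ)) - 1) := mul_le_mul_of_nonneg_left he2 hs0
        have f2 : (((1 - (x ^ (2:ℕ) + (1 - x) * d / w)) * x) - ((x ^ (2:ℕ) + (1 - x) * d / w) * (1 - x) * ((x - r) * (1 - t - r) / (t * (2 - x ^ (2:ℕ) - (1 - x) * r) - x * (x - r)))) / (((1 + t - w) - ((1 - x) * (r + d + 2 * t - 2 * w) + x ^ (2:ℕ) * (1 + t - w))) / ((1 - x) * (r + d + 2 * t - 2 * w) + x ^ (2:ℕ) * (1 + t - w)))) * ((1 - x) / x) = ((1 - (x ^ (2:ℕ) + (1 - x) * d / w)) * x) * ((1 - x) / x) - (((x ^ (2:ℕ) + (1 - x) * d / w) * (1 - x) * ((x - r) * (1 - t - r) / (t * (2 - x ^ (2:ℕ) - (1 - x) * r) - x * (x - r)))) / (((1 + t - w) - ((1 - x) * (r + d + 2 * t - 2 * w) + x ^ (2:ℕ) * (1 + t - w))) / ((1 - x) * (r + d + 2 * t - 2 * w) + x ^ (2:ℕ) * (1 + t - w)))) * ((1 - x) / x) := by ring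
        nlinarith [f1, f2, e1, e2, hμ, hP, mul_nonneg hcM2 he22]
      · rcases lt_or_ge ((r + d)) 1 with h2b | h2n
        · rw [h2P_H h2H h2b] at hpre ⊢
          rcases lt_or_ge ((r + d)) w with h22b | h22n
          · rw [h22_H (le_trans hxw h2H) h22b] at hpre ⊢
            have hG3pos : 0 < ((1 - x) * (r + d + 2 * t - 2 * w) + x ^ (2:ℕ) * (1 + t - w)) := add_pos_of_pos_of_nonneg (mul_pos (by linarith) (by linarith)) (mul_nonneg (sq_nonneg x) (by linarith))
            have he3pos : 0 < (((1 + t - w) - ((1 - x) * (r + d + 2 * t - 2 * w) + x ^ (2:ℕ) * (1 + t - w))) / ((1 - x) * (r + d + 2 * t - 2 * w) + x ^ (2:ℕ) * (1 + t - w))) := div_pos (by nlinarith [mul_pos hx0 (sub_pos.2 hx1), mul_pos hx0 (show (0:ℝ) < 1 + t - w by linarith)]) hG3pos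
            have he3 : (1 - x) / x ≤ (((1 + t - w) - ((1 - x) * (r + d + 2 * t - 2 * w) + x ^ (2:ℕ) * (1 + t - w))) / ((1 - x) * (r + d + 2 * t - 2 * w) + x ^ (2:ℕ) * (1 + t - w))) := by
              rw [div_le_div_iff₀ hx0 hG3pos]; nlinarith [mul_le_mul_of_nonneg_left hk3.le (sub_pos.2 hx1).le]
            have hEX : 0 < (1 - x) / x := div_pos (by linarith) hx0
            have hdv : ((x ^ (2:ℕ) + (1 - x) * d / w) * (1 - x) * ((x - r) * (1 - t - r) / (t * (2 - x ^ (2:ℕ) - (1 - x) * r) - x * (x - r)))) / (((1 + t - w) - ((1 - x) * (r + d + 2 * t - 2 * w) + x ^ (2:ℕ) * (1 + t - w))) / ((1 - x) * (r + d + 2 * t - 2 * w) + x ^ (2:ℕ) * (1 + t - w))) ≤ ((x ^ (2:ℕ) + (1 - x) * d / w) * (1 - x) * ((x - r) * (1 - t - r) / (t * (2 - x ^ (2:ℕ) - (1 - x) * r) - x * (x - r)))) / ((1 - x) / x) := div_le_div_of_nonneg_left hcM1 hEX he3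
            have hAp : 0 < (r + d) := by linarith [h2H]
            have he2p : 0 ≤ (1 / (r + d) - 1) := by rw [sub_nonneg, le_div_iff₀ hAp]; linarith [h2b]
            have hb := mul_le_mul_of_nonneg_right (sub_le_sub_left hdv ((1 - (x ^ (2:ℕ) + (1 - x) * d / w)) * x)) he2p
            have hc := ineq_kG3w_3PLf_H_H x r t d w hx0 hx1 hr0 hrx ht hw0 hw1 hd0 hdx hre hre1 hM1 hM2 hk3 hb3c hf (le_trans hxw h2H) h22b h2H h2b (by simpa only [zero_mul, mul_zero, add_zero, zero_add] using hpre)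
            linarith [hb]
          · rw [h22_N h22n] at hpre ⊢
            rcases le_or_gt (2 * (x ^ (2:ℕ) + (1 - x) * d / w)) 1 with hQ | hQ
            · rcases le_or_gt 1 (2 * x) with hxh | hxl
              · rcases le_or_gt x (2 * (t * (2 - x ^ (2:ℕ) - (1 - x) * r) - x * (x - r))) with hDl | hDs
                · have hc := kG_3PLf_N_H_regionG x r t d w hx0 hx1 hr0 hrx hw0 hd0 hdx hre hre1 hM1 h22n h2H h2b hk3 hQ hDl
                  linarith [hc]
                · have hc := kG_3PLf_N_H_regionPc x r t d w hx0 hx1 hr0 hrx ht hw0 hw1 hd0 hdx hre hre1 hM1 hM2 h22n h2H h2b hk3 hQ hxh hDs.le (by simpa only [mul_zero, zero_add] using hpre)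
                  linarith [hc]
              · rcases le_or_gt (x ^ (2:ℕ)) (t * (2 - x ^ (2:ℕ) - (1 - x) * r) - x * (x - r)) with hDl | hDs
                · have hc := kG_3PLf_N_H_regionG2 x r t d w hx0 hx1 hr0 hrx hw0 hd0 hdx hre hre1 hM1 h22n h2H h2b hk3 hQ hDl
                  linarith [hc]
                · have hc := kG_3PLf_N_H_regionPb x r t d w hx0 hx1 hr0 hrx ht hw0 hw1 hd0 hdx hre hre1 hM1 hM2 h22n h2H h2b hk3 hQ hxl.le hDs.le (by simpa only [mul_zero, zero_add] using hpre)
                  linarith [hc]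
            · have hA0 : 0 < (r + d) := by linarith
              have he2p : 0 ≤ (1 / (r + d) - 1) := by rw [sub_nonneg, le_div_iff₀ hA0]; linarith [h2b]
              have hG3pos : 0 < ((1 - x) * (r + d + 2 * t - 2 * w) + x ^ (2:ℕ) * (1 + t - w)) := add_pos_of_pos_of_nonneg (mul_pos (by linarith) (by linarith)) (mul_nonneg (sq_nonneg x) (by linarith))
              have he3pos : 0 < (((1 + t - w) - ((1 - x) * (r + d + 2 * t - 2 * w) + x ^ (2:ℕ) * (1 + t - w))) / ((1 - x) * (r + d + 2 * t - 2 * w) + x ^ (2:ℕ) * (1 + t - w))) := div_pos (by nlinarith [mul_pos hx0 (sub_pos.2 hx1), mul_pos hx0 (show (0:ℝ) < 1 + t - w by linarith)]) hG3pos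
              have he3 : (1 - x) / x ≤ (((1 + t - w) - ((1 - x) * (r + d + 2 * t - 2 * w) + x ^ (2:ℕ) * (1 + t - w))) / ((1 - x) * (r + d + 2 * t - 2 * w) + x ^ (2:ℕ) * (1 + t - w))) := by
                rw [div_le_div_iff₀ hx0 hG3pos]; nlinarith [mul_le_mul_of_nonneg_left hk3.le (sub_pos.2 hx1).le]
              have hs0 : 0 ≤ (((1 - (x ^ (2:ℕ) + (1 - x) * d / w)) * x) - ((x ^ (2:ℕ) + (1 - x) * d / w) * (1 - x) * ((x - r) * (1 - t - r) / (t * (2 - x ^ (2:ℕ) - (1 - x) * r) - x * (x - r)))) / (((1 + t - w) - ((1 - x) * (r + d + 2 * t - 2 * w) + x ^ (2:ℕ) * (1 + t - w))) / ((1 - x) * (r + d + 2 * t - 2 * w) + x ^ (2:ℕ) * (1 + t - w)))) := by have := (div_le_iff₀ he3pos).2 hf; linarith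
              have hq2 := mul_nonneg (show (0:ℝ) ≤ 2 * (x ^ (2:ℕ) + (1 - x) * d / w) - 1 by linarith) (show (0:ℝ) ≤ 1 - x by linarith)
              nlinarith [mul_nonneg hs0 he2p, hq2, hP]
        · rw [h2P_N h2n, h22_N (le_trans hw1 h2n)] at hpre ⊢
          have hc := ineq_kG_3PLf_N_N x r t d w hx0 hx1 hr0 hrx ht hw0 hw1 hd0 hdx hre hre1 hM1 hM2 hk3 hb3c hf (le_trans hw1 h2n) h2n (by simpa only [zero_mul, mul_zero, add_zero, zero_add] using hpre)
          linarith

  · obtain ⟨hcP, hpl⟩ := hcase_s hs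
    rw [hcP] at hpre ⊢
    rw [hpl]
    clear hcase_f hcase_s
    rcases le_or_gt (x * (1 + t - w)) ((r + d + 2 * t - 2 * w)) with hk3 | hk3
    · rw [h3_H hk3] at *
      have he22 : 0 ≤ e22 := by
        rcases lt_or_ge ((r + d)) (x * w) with h1 | h1
        · rw [h22_L h1]
          have hG2 : 0 < ((1 - x) * (r + d) + x ^ (2:ℕ) * w) := by positivity
          rw [sub_nonneg, le_div_iff₀ hG2]; nlinarith [mul_pos hx0 hx0]
        · rcases lt_or_ge ((r + d)) w with h2 | h2
          · rw [h22_H h1 h2]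
            have hA : 0 < (r + d) := by nlinarith [mul_pos hx0 hw0]
            rw [sub_nonneg, le_div_iff₀ hA]; linarith
          · rw [h22_N h2]
      have he3pos : 0 < (((1 + t - w) - (r + d + 2 * t - 2 * w)) / (r + d + 2 * t - 2 * w)) := div_pos (by linarith) (by linarith)
      by_cases hq : (1 - x) - x * (((1 + t - w) - (r + d + 2 * t - 2 * w)) / (r + d + 2 * t - 2 * w)) ≤ 0
      · have hq1 : 1 - x ≤ x * (((1 + t - w) - (r + d + 2 * t - 2 * w)) / (r + d + 2 * t - 2 * w)) := by linarith
        have hq2 := mul_le_mul_of_nonneg_left hq1 hg1p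
        nlinarith [hP, hgl, hq2, mul_nonneg hcM2 he22]
      · have hq' : 0 < (1 - x) - x * (((1 + t - w) - (r + d + 2 * t - 2 * w)) / (r + d + 2 * t - 2 * w)) := not_le.1 hq
        have hW := ineq_W_3PH x r t d w hx0 hx1 hr0 hrx ht hw0 hw1 hd0 hdx hre hre1 hM1 hM2 hk3 hb3c
        have h1 := mul_lt_mul_of_pos_right hs hq'
        have hWq : ((x - r) * (1 - t - r) / (t * (2 - x ^ (2:ℕ) - (1 - x) * r) - x * (x - r))) * ((1 - x) - x * (((1 + t - w) - (r + d + 2 * t - 2 * w)) / (r + d + 2 * t - 2 * w))) ≤ ((1 + x - r) * (r - x + t * (2 - x)) / (t * (2 - x ^ (2:ℕ) - (1 - x) * r) - x * (x - r))) * (x * (((1 + t - w) - (r + d + 2 * t - 2 * w)) / (r + d + 2 * t - 2 * w))) := by nlinarith [hW]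
        have h2 := mul_le_mul_of_nonneg_left hWq (mul_nonneg hg0 (by linarith : (0:ℝ) ≤ 1 - x))
        have h3 : (x * (((1 + t - w) - (r + d + 2 * t - 2 * w)) / (r + d + 2 * t - 2 * w))) * ((1 - (x ^ (2:ℕ) + (1 - x) * d / w)) * ((1 - x) - x * (((1 + t - w) - (r + d + 2 * t - 2 * w)) / (r + d + 2 * t - 2 * w)))) < (x * (((1 + t - w) - (r + d + 2 * t - 2 * w)) / (r + d + 2 * t - 2 * w))) * ((x ^ (2:ℕ) + (1 - x) * d / w) * (1 - x) * ((1 + x - r) * (r - x + t * (2 - x)) / (t * (2 - x ^ (2:ℕ) - (1 - x) * r) - x * (x - r)))) := by nlinarith [h1, h2]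
        have h4 : (1 - (x ^ (2:ℕ) + (1 - x) * d / w)) * ((1 - x) - x * (((1 + t - w) - (r + d + 2 * t - 2 * w)) / (r + d + 2 * t - 2 * w))) < (x ^ (2:ℕ) + (1 - x) * d / w) * (1 - x) * ((1 + x - r) * (r - x + t * (2 - x)) / (t * (2 - x ^ (2:ℕ) - (1 - x) * r) - x * (x - r))) := lt_of_mul_lt_mul_left h3 (by positivity)
        nlinarith [hP, h4, hgsum, mul_nonneg hcM2 he22]

    · rw [h3_L hk3] at *
      have he22 : 0 ≤ e22 := by
        rcases lt_or_ge ((r + d)) (x * w) with h1 | h1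
        · rw [h22_L h1]
          have hG2 : 0 < ((1 - x) * (r + d) + x ^ (2:ℕ) * w) := by positivity
          rw [sub_nonneg, le_div_iff₀ hG2]; nlinarith [mul_pos hx0 hx0]
        · rcases lt_or_ge ((r + d)) w with h2 | h2
          · rw [h22_H h1 h2]
            have hA : 0 < (r + d) := by nlinarith [mul_pos hx0 hw0]
            rw [sub_nonneg, le_div_iff₀ hA]; linarith
          · rw [h22_N h2]
      have hG3pos : 0 < ((1 - x) * (r + d + 2 * t - 2 * w) + x ^ (2:ℕ) * (1 + t - w)) := add_pos_of_pos_of_nonneg (mul_pos (by linarith) (by linarith)) (mul_nonneg (sq_nonneg x) (by linarith))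
      have he3pos : 0 < (((1 + t - w) - ((1 - x) * (r + d + 2 * t - 2 * w) + x ^ (2:ℕ) * (1 + t - w))) / ((1 - x) * (r + d + 2 * t - 2 * w) + x ^ (2:ℕ) * (1 + t - w))) := div_pos (by nlinarith [mul_pos hx0 (sub_pos.2 hx1), mul_pos hx0 (show (0:ℝ) < 1 + t - w by linarith)]) hG3pos
      have he3 : (1 - x) / x ≤ (((1 + t - w) - ((1 - x) * (r + d + 2 * t - 2 * w) + x ^ (2:ℕ) * (1 + t - w))) / ((1 - x) * (r + d + 2 * t - 2 * w) + x ^ (2:ℕ) * (1 + t - w))) := by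
        rw [div_le_div_iff₀ hx0 hG3pos]; nlinarith [mul_le_mul_of_nonneg_left hk3.le (sub_pos.2 hx1).le]
      have hq : 1 - x ≤ x * (((1 + t - w) - ((1 - x) * (r + d + 2 * t - 2 * w) + x ^ (2:ℕ) * (1 + t - w))) / ((1 - x) * (r + d + 2 * t - 2 * w) + x ^ (2:ℕ) * (1 + t - w))) := by have := (div_le_iff₀ hx0).1 he3; linarith
      have hq2 := mul_le_mul_of_nonneg_left hq hg1p
      nlinarith [hP, hgl, hq2, mul_nonneg hcM2 he22]


end LSCoreLMG

end LawDec

end Quant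

end Summit.CriticalPhenomena.PercolationContinuityZ3.Theorems
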